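import Summits.ResolutionOfSingularities.ResolutionOfSingularities.Theorems.DeltaCutNerveRound

/-!
# DeltaCutNerveCertificates — lens-6 g31 node «NerveCut», part 3/3: RING CERTIFICATES + NODE SUMMARY
# THE RESIDUAL KIND P‴ (`E1TopSPerpetual`) IS INHABITED: D₀ = `(x², z⁶·w⁶)`, n = 2, char 2, is S-PERPETUAL;
# BARRIER «deepest-stratum-first laws diverge on normal-crossings monomial loci» (certificate D₀, Theorem B);
# COMPLEMENT «the minimal-face law terminates» (Theorem A, kernel, via the Dershowitz–Manna order)

Column: host route `MaxContactCut`, column item `E1TopNoAbs` (stmt-…-26971), live aside `GCE1TopGHeavy` (…-27045).  The g30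
node `SingCut` located the residual of `E1TopGHeavy` at `E1TopSHeavy ↔ E1TopSFrozen ∧ E1TopSPerpetual` (`DeltaCutSingCells`),
with `E1TopSPerpetual := ∀ n ≥ 1, WORTopSPerpetual n` tagged «P‴ · UNDECIDED · NO INHABITANT KNOWN».  The g30 repair attempt
«SurfCut» (a CJS-B round on the reduced top locus) was conceded at cn37: its recurrence bound is desk-false on
D₀ = `(𝔸⁴, (x², z⁶w⁶))`, whose round produces the label chain `[6,6] → [4,10,4] → [2,12,8,12,2] → …` (HOME `g30/frame/CN37.md`).

## §0 THE FINDING (this node): cn37's chain IS the tree's singular run — P‴ is inhabited, and WOR holds there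

At every level of the singular run (`DeltaCutSing.sHop`) from `⟨(𝔸⁴_k, (x², z⁶w⁶)), none⟩`, `char k = 2`, the bad closure is a
CHAIN of regular surfaces inside the strict transform of `H = {x = 0}` (labels = orders of the monomial generator along them,
ALIVE iff label `≥ 2`), at most two through a point, crossing normally along pairwise DISJOINT regular curves: the level is
`SingFrozen` (bad `≠ ∅`, closure and surface part not regular at the crossings, not a curve, `Sing(Σ_red)` = the disjoint
crossing curves = regular), `sHop` fires STEP 1 = blow up ALL crossing curves (a newborn plane of label `a + b − 2` between
parents `a, b`), `OldSurfRegular` holds (the crossings are separated), STEP 2 = blow up ALL old planes (label `a ↦ a − 2`).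
In every chart the datum stays `(x'², uᵃ·vᵇ)` or `(x'², uᵃ)` (the `x`-charts are empty), so the run is the map `SRound.sRound 2`
on label strings, letter for letter (§C is the chart dictionary, §B the string dynamics):
`[6,6] → [4,10,4] → [2,12,8,12,2] → [0,12,10,18,6,18,10,12,0] → (max 26) → (max 40) → …` = CN37's table (`SRound.D0_rounds`).
A LIVE EDGE (adjacent labels `≥ 2n, ≥ n`) survives every round (`liveEdge_sRound`), so the bad locus is never empty:
`SPerpetual 2 ⟨D₀, none⟩` — KIND P‴ IS INHABITED.  A HEAVY EDGE (`≥ 3n, ≥ 2n`) makes the labels grow by `≥ n` per round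
(`heavyEdge_unbounded`): unbounded.  And `WOR 2` HOLDS at D₀: blowing up `P_z` thrice then `P_w` thrice resolves
(`NC_planeChart` read six times) — the inhabitant refutes the LAW (and every deepest-stratum-first law), not the summit.
Why every closed point of an alive plane is BAD in characteristic 2: both generators are SQUARES (`x²`, `(z³w³)²`, and at
later levels `u^{2a'} v^{2b'}` — all labels stay even), so every derivation kills them (`NC_noContact`: no absolute contact,
`Diff^{≤1}_ℤ I ⊆ 𝔪²` with `NC_wild`), and the INERT chart `y` of the point blow-up is a near point (`NC_near`: δ-heavy).
Second inhabitant, with STATIONARY labels: D₁ = `(x², z⁴w²)`, char 2 — the n.c. string `[4, 2]` from the start, and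
`[4,2] → [2,4,0] → [0,4,2,0] → …` for ever (`SRound.periodic_orbit`): S-perpetual with `max label = 4` at every level.

## §A THEOREM A — THE NERVE GAME: MINIMAL-FACE PLAYS TERMINATE (the complement; kernel, hypothesis-free)

New object `Nerve.State` = (faces `K : Finset (Finset ℕ)` of the dual complex of the boundary on `H`, labels `a : ℕ → ℕ`);
a face is PERMISSIBLE at marking `n` iff its weight `Σ a` is `≥ n`; a MOVE = stellar subdivision at a permissible face `F₀`
with a fresh vertex of label `a(F₀) − n` (= blowing up the stratum of `F₀`; `Nerve.stellar`, `Nerve.State.move`).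
`Nerve.IsMinMove n s t`: the face blown up has MINIMAL CARDINALITY among the permissible faces (Encinas–Villamayor's `Γ`:
least codimension first; ANY tie-break).  **`Nerve.isMinMove_wf` / `Nerve.no_infinite_minPlay`: on downward-closed complexes
every minimal-face play is FINITE** — potential `(D − min|F|, multiset of weights of the minimal-size permissible faces)` in
`ℕ ×ₗₑₓ (Multiset ℕ, Relation.CutExpand (<))` (`Mathlib.Logic.Hydra`): no smaller permissible face is born
(`card_le_of_perm_move`), the newcomers of the minimal size are lighter than `a(F₀)` (`weight_lt_of_perm_move`), `F₀` is gone.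
At D₀ the game is inhabited and its first centre is a VERTEX, not the edge (`D0nerve_isMinMove`).

## §B THEOREM B — THE CROSSING-FIRST ROUND ON LABEL STRINGS: PERPETUAL, UNBOUNDED, MEASURE-FREE (the barrier)

`SRound.sRound n` (step 1: insert `a + b − n` between alive neighbours; step 2: decrement every old label by `n`);
`LiveEdge` / `HeavyEdge` invariants (`liveEdge_sRound`, `heavyEdge_sRound`, `…_iterate`, `heavyEdge_unbounded`);
`SRound.no_termination_measure`: NO map to ANY well-founded order drops along a round on every live string — the door
«P‴ invariant WHOLE» (a well-founded quantity decreasing on every S-move) is CLOSED FOR CAUSE; the D₀ rows (`D0_rounds`,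
`D0_live_forever`, `D0_unbounded`) and the periodic orbit.

## §C RING CERTIFICATES (column dictionary, `MvPolynomial (Fin 4) K`, `0 = x, 1 = y, 2 = z, 3 = w`)

`NC_top` (T: top locus of `(x², zᵃwᵇ)` inside `P_z ∪ P_w`), `NC_wild` (W), `NC_planes`, `NC_closure_not_prime` (R′: two planes
through a line are not regular there — `¬ ClosureRegular`, `¬ SurfaceRegular`), `pderiv_sq_eq_zero` / `NC_noContact` (char 2),
`NC_near` (N: δ-heavy via the inert chart), `NC_symm` (`z ↔ w`), `NC_lineChart` (STEP 1, generic labels: newborn `a + b + 2`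
from alive `a + 2, b + 2`; `x`-chart unit), `NC_planeChart` (STEP 2 and the six-step WOR chain: label `−2`; `x`-chart unit),
`D0_certificate` (conjunction).  PLAINLY: D₀'s perpetuity is RING-CERTIFIED to s-height 3 (the three explicit rounds, chart
by chart, with the generic-exponent identities) and LIST-MODEL beyond (`SRound`, all heights); the global bookkeeping of the
chain (which planes cross, disjointness of the crossing lines) is desk (`NODE-g31.md` §1).

## CELL-LEVEL READING (honest; rung 0 — nothing here proves the summit or `E 1`)

* `E1TopSPerpetual` (P‴): **INHABITED** by D₀ (was «no inhabitant known»; ring-certified to s-height 3, list-model beyond);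
  still UNDECIDED as a statement (`→ WOR`), NOT vacuous; `WOR 2` true at the inhabitant.  `E1TopSFrozen` (F-ss², T₃) unchanged.  P″ (`GPerpetual`) unchanged: D₀ is G-frozen,
  and no monomial datum is G-perpetual (`GradeNow` needs a crossing-free surface part; growth needs crossings) — desk.
* Door «P‴ invariant WHOLE» (critic row 210: a well-founded quantity with `…_lt_of_sMoves` for every moving s-hop): **DEAD FOR
  CAUSE** (`SRound.no_termination_measure` + the dictionary; the periodic inhabitant even has stationary labels).
* BARRIER (typed at nerve level; certificate = Theorem B + D₀; class «StratumFirst», cf. `Literature/Barriers/…/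
  StratumFirstInvIncrease`, `HardPolyhedraGameTwoCycle`): «memoryless deepest-stratum-first laws — the column's run / sep /
  ref / grade / sing hops and SurfCut rev 1 (CJS on the reduced top locus, boundary reset) — DIVERGE on normal-crossings
  monomial order-`n` loci `(x², (zw)^c)`, `c ≥ 4` even, dim 4, char 2».  LEAF TAG: BARRIER (certified).
* COMPLEMENT (typed, PROVED = Theorem A): «shallowest-stratum-first (least codimension among permissible boundary strata, then
  weight; E-V) TERMINATES in the monomial regime» = the design rule (R3′) for the boundary-carrying round SurfCut-B (critic
  222i: shape (β) — accumulated boundary, monomial part split off, CJS_B on the non-boundary components) and the recurrence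
  bound OF ITS MONOMIAL PHASE.  LEAF TAG: ATTACKABLE (g32: the transfer lemma «monomial phase of SurfCut-B on a stage whose bad
  closure is boundary-supported n.c. = a minimal-face nerve play», then the WHOLE bound mod `(E j, hCJS)` — NOT claimed here).
* Paper runs of (β)/(R3′) on the critic's families (`NODE-g31.md` §3, desk): `(x², (zw)^c)` and `(x², zᵃwᵇ)` — (β)
  terminates (CJS_B: the crossing line, then the two separated planes; then pure E-V decrements), the s-law diverges iff a
  live edge survives round 1; `(x², (yzw)^c)` = three pairwise-crossing planes — s-law FROZEN-STUCK at level 0 (three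
  concurrent axes: `¬ SingRegular`, kind F-ss² = T₃'s class), (β): origin → three separated axes → three disjoint planes →
  monomial phase — kept UNDECIDED (desk sketch only, critic 222j); `(x², (z²−w³)^c)` (cusp sheet; after one hop the exceptional plane is TANGENT to the resolved
  sheet = the «boundary meets non-boundary tangentially» family): `c = 2` the s-run terminates in two rounds, `c = 4` three
  forced s-hops (tangency curve → three sheets through a line → n.c. chain `[4, 12, 4]`) and then divergence by Theorem B;
  (β) agrees for those three centres (CJS_B Stage: make `X ∪ B` n.c.) and then decrements to the end.

WHY NOVEL (lens 6, by construction different from lens-1 «MonomialBlowup» (CoP1 Prop 8.1 port for RelLU), lens-2 «JumpCut»,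
lens-3 «LossEpisode» automaton, lens-4 «CouplingMap», lens-5 «WallFrames»/«WildDescent»): a DUAL-COMPLEX (nerve) termination /
divergence PAIR for the dim-4 order-`n` column — the first inhabitant of the perpetual kind, the first measure-free divergence
theorem for the column's law class, and a kernel termination theorem for the complementary law, all on one object.
WHY WEAKER: no piece of a route is added or claimed; Theorem A is a theorem (not a crux), the barrier is a certified negative.

Provenance: cn37 (critic, 2026-08-31) and `g30/frame/CN37.md` (desk chain); E-V `Γ` (Encinas–Villamayor, Acta Math. Vietnam.
2007 / «A course on constructive desingularization» §monomial case) for the minimal-codimension rule; Dershowitz–Manna for the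
multiset order (`Mathlib.Logic.Hydra`).  Imports: LANDED column files only (`DeltaCutSingCertificates` for `chartSubst`,
`linChartSubst`, `X_not_mem_span_pair/triple`, `X_mem_spanX4`).  0 sorry · standard axioms.
-/

noncomputable section

open CategoryTheory CategoryTheory.Limits AlgebraicGeometry TopologicalSpace IsLocalRing
open Literature.AlgebraicGeometry.Resolution

namespace Summit.ResolutionOfSingularities.ResolutionOfSingularities.Theorems.DeltaCutClasses

/-! ## §C RING CERTIFICATES: the normal-crossings monomial data `(x², zᵃ·wᵇ)` and the inhabitant D₀ = `(x², z⁶w⁶)`, char 2 -/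

section NCCertificates

open MvPolynomial
variable {K : Type*} [Field K]

/-! Coordinates `0 = x, 1 = y (inert), 2 = z, 3 = w`; the datum is the PAIR of generators `(X 0 ^ 2, X 2 ^ a * X 3 ^ b)`
(order-`2` column, `n = 2`), read generator by generator in the column's certificate dictionary
(`DeltaCutSepCertificates` … `DeltaCutSingCertificates`): (ord) `s ∉ 𝔮, s·g ∈ 𝔮²`; WILD = both generators in `𝓘(P)²`;
NEAR = a chart origin of the point blow-up where both controlled generators lie in `𝔫'²`; (L) Rees charts
`linChartSubst A e` / `chartSubst e`. -/

/-- A power of a variable in a prime ideal puts the variable in it. NerveCut (lens-6 g31) helper; docstring added by the writer (lint.docstring). -/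
theorem X_mem_of_pow_mem (𝔮 : Ideal (MvPolynomial (Fin 4) K)) [h𝔮 : 𝔮.IsPrime] {i : Fin 4} {k : ℕ}
    (h : (X i : MvPolynomial (Fin 4) K) ^ k ∈ 𝔮) : (X i : MvPolynomial (Fin 4) K) ∈ 𝔮 := by
  rcases Nat.eq_zero_or_pos k with rfl | _
  · rw [pow_zero] at h; exact absurd ((Ideal.eq_top_iff_one 𝔮).2 h) h𝔮.ne_top
  · exact h𝔮.mem_of_pow_mem k h

/-- **NC — (T) THE TOP LOCUS of `(x², zᵃwᵇ)` LIES IN `P_z ∪ P_w = V(x, z·w)`**: a prime `𝔮` along which BOTH generators have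
order `≥ 2` (indeed `≥ 1`) contains `x` and one of `z, w` (the one with a positive exponent). [new; elementary] [folklore] -/
theorem NC_top (𝔮 : Ideal (MvPolynomial (Fin 4) K)) [𝔮.IsPrime] {s : MvPolynomial (Fin 4) K} (hs : s ∉ 𝔮) (a b : ℕ)
    (h0 : s * (X 0 ^ 2 : MvPolynomial (Fin 4) K) ∈ 𝔮 ^ 2) (h1 : s * (X 2 ^ a * X 3 ^ b : MvPolynomial (Fin 4) K) ∈ 𝔮 ^ 2) :
    (X 0 : MvPolynomial (Fin 4) K) ∈ 𝔮 ∧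
      ((a ≠ 0 ∧ (X 2 : MvPolynomial (Fin 4) K) ∈ 𝔮) ∨ (b ≠ 0 ∧ (X 3 : MvPolynomial (Fin 4) K) ∈ 𝔮)) := by
  have hP := ‹𝔮.IsPrime›
  have g0 : (X 0 : MvPolynomial (Fin 4) K) ^ 2 ∈ 𝔮 := (hP.mem_or_mem (Ideal.pow_le_self two_ne_zero h0)).resolve_left hs
  have g1 : (X 2 ^ a * X 3 ^ b : MvPolynomial (Fin 4) K) ∈ 𝔮 :=
    (hP.mem_or_mem (Ideal.pow_le_self two_ne_zero h1)).resolve_left hs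
  refine ⟨hP.mem_of_pow_mem 2 g0, ?_⟩
  rcases hP.mem_or_mem g1 with h2 | h3
  · refine Or.inl ⟨?_, X_mem_of_pow_mem 𝔮 h2⟩
    rintro rfl; rw [pow_zero] at h2; exact hP.ne_top ((Ideal.eq_top_iff_one 𝔮).2 h2)
  · refine Or.inr ⟨?_, X_mem_of_pow_mem 𝔮 h3⟩
    rintro rfl; rw [pow_zero] at h3; exact hP.ne_top ((Ideal.eq_top_iff_one 𝔮).2 h3)

/-- **NC — (W) EVERY ALIVE PLANE (label `≥ 2`) LIES IN THE TOP LOCUS AND THE DATUM IS WILD ALONG IT**: both generators lie in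
`𝓘(P_z)² = (x, z)²` when the `z`-label is `a + 2 ≥ 2`; and along the crossing line `L = V(x, z, w)` of two alive planes both
generators lie in `𝓘(L)²`. [new; elementary] [folklore] -/
theorem NC_wild (a b : ℕ) :
    (X 0 ^ 2 : MvPolynomial (Fin 4) K) ∈ (Ideal.span {(X 0 : MvPolynomial (Fin 4) K), X 2}) ^ 2 ∧
      (X 2 ^ (a + 2) * X 3 ^ b : MvPolynomial (Fin 4) K) ∈ (Ideal.span {(X 0 : MvPolynomial (Fin 4) K), X 2}) ^ 2 ∧
      (X 0 ^ 2 : MvPolynomial (Fin 4) K) ∈ (Ideal.span {(X 0 : MvPolynomial (Fin 4) K), X 2, X 3}) ^ 2 ∧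
      (X 2 ^ (a + 1) * X 3 ^ (b + 1) : MvPolynomial (Fin 4) K) ∈ (Ideal.span {(X 0 : MvPolynomial (Fin 4) K), X 2, X 3}) ^ 2 := by
  have a0 : (X 0 : MvPolynomial (Fin 4) K) ∈ Ideal.span {(X 0 : MvPolynomial (Fin 4) K), X 2} := Ideal.subset_span (by simp)
  have a2 : (X 2 : MvPolynomial (Fin 4) K) ∈ Ideal.span {(X 0 : MvPolynomial (Fin 4) K), X 2} := Ideal.subset_span (by simp)
  have b0 : (X 0 : MvPolynomial (Fin 4) K) ∈ Ideal.span {(X 0 : MvPolynomial (Fin 4) K), X 2, X 3} :=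
    Ideal.subset_span (by simp)
  have b2 : (X 2 : MvPolynomial (Fin 4) K) ∈ Ideal.span {(X 0 : MvPolynomial (Fin 4) K), X 2, X 3} :=
    Ideal.subset_span (by simp)
  have b3 : (X 3 : MvPolynomial (Fin 4) K) ∈ Ideal.span {(X 0 : MvPolynomial (Fin 4) K), X 2, X 3} :=
    Ideal.subset_span (by simp)
  refine ⟨Ideal.pow_mem_pow a0 2, ?_, Ideal.pow_mem_pow b0 2, ?_⟩
  · rw [show (X 2 ^ (a + 2) * X 3 ^ b : MvPolynomial (Fin 4) K) = X 2 ^ 2 * (X 2 ^ a * X 3 ^ b) by ring]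
    exact Ideal.mul_mem_right _ _ (Ideal.pow_mem_pow a2 2)
  · rw [show (X 2 ^ (a + 1) * X 3 ^ (b + 1) : MvPolynomial (Fin 4) K) = X 2 * X 3 * (X 2 ^ a * X 3 ^ b) by ring, sq]
    exact Ideal.mul_mem_right _ _ (Ideal.mul_mem_mul b2 b3)

/-- the alive planes ARE planes and the crossing line IS a line (`y, w ∉ (x, z)`, `y ∉ (x, z, w)`): the bad closure is not a
curve, and `V(x, z, w)` — the singular locus of `P_z ∪ P_w` — is a regular line. [new; elementary] [folklore] -/
theorem NC_planes :
    (X 1 : MvPolynomial (Fin 4) K) ∉ Ideal.span {(X 0 : MvPolynomial (Fin 4) K), X 2} ∧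
      (X 3 : MvPolynomial (Fin 4) K) ∉ Ideal.span {(X 0 : MvPolynomial (Fin 4) K), X 2} ∧
      (X 1 : MvPolynomial (Fin 4) K) ∉ Ideal.span {(X 0 : MvPolynomial (Fin 4) K), X 3} ∧
      (X 2 : MvPolynomial (Fin 4) K) ∉ Ideal.span {(X 0 : MvPolynomial (Fin 4) K), X 3} ∧
      (X 1 : MvPolynomial (Fin 4) K) ∉ Ideal.span {(X 0 : MvPolynomial (Fin 4) K), X 2, X 3} :=
  ⟨X_not_mem_span_pair (by decide) (by decide), X_not_mem_span_pair (by decide) (by decide),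
    X_not_mem_span_pair (by decide) (by decide), X_not_mem_span_pair (by decide) (by decide),
    X_not_mem_span_triple (by decide) (by decide) (by decide)⟩

/-- **NC — (R′) TWO ALIVE PLANES THROUGH A LINE ARE NOT A REGULAR SURFACE at the line**: `z·w ∈ 𝓘(P_z) ∩ 𝓘(P_w)` while
`z, w ∉` — the local ring of `P_z ∪ P_w` at a point of `L` is not a domain: `¬ ClosureRegular`, `¬ SurfaceRegular` at
every level carrying a live edge. [new; elementary] [folklore] -/
theorem NC_closure_not_prime :
    (X 2 * X 3 : MvPolynomial (Fin 4) K) ∈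
        Ideal.span {(X 0 : MvPolynomial (Fin 4) K), X 2} ⊓ Ideal.span {(X 0 : MvPolynomial (Fin 4) K), X 3} ∧
      (X 2 : MvPolynomial (Fin 4) K) ∉
        Ideal.span {(X 0 : MvPolynomial (Fin 4) K), X 2} ⊓ Ideal.span {(X 0 : MvPolynomial (Fin 4) K), X 3} ∧
      (X 3 : MvPolynomial (Fin 4) K) ∉
        Ideal.span {(X 0 : MvPolynomial (Fin 4) K), X 2} ⊓ Ideal.span {(X 0 : MvPolynomial (Fin 4) K), X 3} := by
  refine ⟨⟨Ideal.mul_mem_right _ _ (Ideal.subset_span (by simp)), Ideal.mul_mem_left _ _ (Ideal.subset_span (by simp))⟩,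
    fun h => NC_planes.2.2.2.1 h.2, fun h => NC_planes.2.1 h.1⟩

/-- in characteristic `2` every coordinate derivation kills every SQUARE. [elementary] [folklore] -/
theorem pderiv_sq_eq_zero [CharP K 2] (i : Fin 4) (f : MvPolynomial (Fin 4) K) : pderiv i (f ^ 2) = 0 := by
  rw [Derivation.leibniz_pow, two_nsmul, CharTwo.add_self_eq_zero]

/-- **NC — NO ABSOLUTE CONTACT in characteristic 2 with EVEN labels**: both generators `x² = (x)²` and
`z^{2a}·w^{2b} = (zᵃwᵇ)²` are squares, so EVERY derivation (over `ℤ`, i.e. over the prime field) kills them: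
`Diff^{≤1}(I) = I ⊆ 𝔪_y²` at every point of an alive plane (with (W)) — no order-`≤ 1` operator produces a regular parameter:
`¬ IsAbsContactAt I 2 y`. [new; elementary] [folklore] -/
theorem NC_noContact [CharP K 2] (i : Fin 4) (a b : ℕ) :
    pderiv i (X 0 ^ 2 : MvPolynomial (Fin 4) K) = 0 ∧ pderiv i (X 2 ^ (2 * a) * X 3 ^ (2 * b) : MvPolynomial (Fin 4) K) = 0 := by
  refine ⟨pderiv_sq_eq_zero i _, ?_⟩
  rw [show (X 2 ^ (2 * a) * X 3 ^ (2 * b) : MvPolynomial (Fin 4) K) = (X 2 ^ a * X 3 ^ b) ^ 2 by ring]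
  exact pderiv_sq_eq_zero i _

/-- **NC — SYMMETRY `z ↔ w`** (every statement about `P_z` holds for `P_w`). [new; elementary] [folklore] -/
theorem NC_symm (a b : ℕ) :
    rename (Equiv.swap 2 3) (X 2 ^ a * X 3 ^ b : MvPolynomial (Fin 4) K) = X 2 ^ b * X 3 ^ a ∧
      rename (Equiv.swap 2 3) (X 0 ^ 2 : MvPolynomial (Fin 4) K) = X 0 ^ 2 := by
  constructor <;> (simp [rename_X, Equiv.swap_apply_def]; try ring)

/-- **NC — (N) EVERY CLOSED POINT `c = (0, y₀, 0, c₃)` OF AN ALIVE PLANE `P_z` (label `a + 2 ≥ 2`) HAS A NEAR POINT** — the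
origin of the INERT chart `y` of the point blow-up at `c`: translated to `c` the monomial generator is `z^{a+2}·(w + c₃)ᵇ`
(the generators do not involve `y`); chart `y` (`x ↦ x·y, z ↦ z·y, w ↦ w·y`) gives `y²·x'²` and `y²·(yᵃ·z'^{a+2}·Φ)`, and both
controlled generators `x'²`, `yᵃ z'^{a+2} Φ` lie in `𝔫'²` for EVERY cofactor: the point is δ-HEAVY (`¬ DeltaLightAt`, by the
kernel `noNearPointOver_of_deltaLightAt` read contrapositively).  With (W) and `NC_noContact`: every closed point of an alive
plane is BAD — bad₀ = all closed points of the alive planes, NONEMPTY while a label is `≥ 2`. [new; elementary] [folklore] -/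
theorem NC_near (a b : ℕ) (c : K) :
    aeval (fun j : Fin 4 => if j = 3 then (X 3 + C c : MvPolynomial (Fin 4) K) else X j)
          (X 2 ^ (a + 2) * X 3 ^ b : MvPolynomial (Fin 4) K) = X 2 ^ (a + 2) * (X 3 + C c) ^ b ∧
      aeval (chartSubst (K := K) 1) (X 0 ^ 2 : MvPolynomial (Fin 4) K) = X 1 ^ 2 * X 0 ^ 2 ∧
      aeval (chartSubst (K := K) 1) (X 2 ^ (a + 2) * (X 3 + C c) ^ b : MvPolynomial (Fin 4) K) =
        X 1 ^ 2 * (X 1 ^ a * X 2 ^ (a + 2) * (X 1 * X 3 + C c) ^ b) ∧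
      ∀ Φ : MvPolynomial (Fin 4) K,
        (X 0 ^ 2 : MvPolynomial (Fin 4) K) ∈ (Ideal.span {(X 0 : MvPolynomial (Fin 4) K), X 1, X 2, X 3}) ^ 2 ∧
          (X 1 ^ a * X 2 ^ (a + 2) * Φ : MvPolynomial (Fin 4) K) ∈
            (Ideal.span {(X 0 : MvPolynomial (Fin 4) K), X 1, X 2, X 3}) ^ 2 := by
  refine ⟨?_, ?_, ?_, fun Φ => ⟨Ideal.pow_mem_pow (X_mem_spanX4 0) 2, ?_⟩⟩
  · simp only [map_mul, map_pow, aeval_X, Fin.isValue, if_true, show (2 : Fin 4) ≠ 3 by decide, if_false]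
  · simp [chartSubst]; ring
  · simp [chartSubst]; ring
  · rw [show (X 1 ^ a * X 2 ^ (a + 2) * Φ : MvPolynomial (Fin 4) K) = X 2 ^ 2 * (X 1 ^ a * X 2 ^ a * Φ) by ring]
    exact Ideal.mul_mem_right _ _ (Ideal.pow_mem_pow (X_mem_spanX4 2) 2)

/-- **NC — STEP 1 OF THE ROUND (blow up the crossing line `L = V(x, z, w)` of two ALIVE planes, labels `a + 2, b + 2`)**,
chart by chart: chart `z` — `x² ↦ z²·x'²`, `z^{a+2} w^{b+2} ↦ z²·(z^{a+b+2}·w'^{b+2})`: the NEWBORN plane `V(x', z)`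
(exceptional) carries the label `a + b + 2 = (a+2) + (b+2) − 2` and crosses the old plane `V(x', w')` (label `b + 2`);
chart `w` — mirror image; chart `x` — `x² ↦ x²·1`: the controlled transform is the unit ideal, NO POINTS.  This is the
letter-for-letter dictionary `[…, a+2, b+2, …] ↦ […, a+2, a+b+2, b+2, …]` of `SRound.sRound` (step 1). [new; elementary]
[folklore] -/
theorem NC_lineChart (a b : ℕ) :
    aeval (linChartSubst (K := K) {0, 2, 3} 2) (X 0 ^ 2 : MvPolynomial (Fin 4) K) = X 2 ^ 2 * X 0 ^ 2 ∧
      aeval (linChartSubst (K := K) {0, 2, 3} 2) (X 2 ^ (a + 2) * X 3 ^ (b + 2) : MvPolynomial (Fin 4) K) =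
        X 2 ^ 2 * (X 2 ^ (a + b + 2) * X 3 ^ (b + 2)) ∧
      aeval (linChartSubst (K := K) {0, 2, 3} 3) (X 0 ^ 2 : MvPolynomial (Fin 4) K) = X 3 ^ 2 * X 0 ^ 2 ∧
      aeval (linChartSubst (K := K) {0, 2, 3} 3) (X 2 ^ (a + 2) * X 3 ^ (b + 2) : MvPolynomial (Fin 4) K) =
        X 3 ^ 2 * (X 2 ^ (a + 2) * X 3 ^ (a + b + 2)) ∧
      aeval (linChartSubst (K := K) {0, 2, 3} 0) (X 0 ^ 2 : MvPolynomial (Fin 4) K) = X 0 ^ 2 * 1 := by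
  refine ⟨?_, ?_, ?_, ?_, ?_⟩ <;> (simp [linChartSubst]; try ring)

/-- **NC — STEP 2 OF THE ROUND (blow up an old ALIVE plane, label `a + 2`)** and **THE WOR CHAIN**, chart by chart: centre
`P_z = V(x, z)`, chart `z` — `x² ↦ z²·x'²`, `z^{a+2}·wᵇ ↦ z²·(zᵃ·wᵇ)`: the plane reappears as `V(x', z)` with label `a =
(a+2) − 2`, its neighbours unchanged; chart `x` — unit ideal, no points; centre `P_w` — mirror image.  Dictionary
`[…, a+2, …] ↦ […, a, …]` of `SRound.sRound` (step 2).  The SAME identity read six times is a WEAK ORDERED RESOLUTION of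
D₀ = `(x², z⁶w⁶)`: blow up `P_z` thrice (`z`-labels `6 → 4 → 2 → 0`, each centre a regular plane inside the order-2 locus by
(W)), then `P_w` thrice (`6 → 4 → 2 → 0`), ending with the monomial generator a unit: `WOR 2` HOLDS AT D₀ — the inhabitant
refutes no conjunct of the summit, it refutes the LAW. [new; elementary] [folklore] -/
theorem NC_planeChart (a b : ℕ) :
    aeval (linChartSubst (K := K) {0, 2} 2) (X 0 ^ 2 : MvPolynomial (Fin 4) K) = X 2 ^ 2 * X 0 ^ 2 ∧
      aeval (linChartSubst (K := K) {0, 2} 2) (X 2 ^ (a + 2) * X 3 ^ b : MvPolynomial (Fin 4) K) =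
        X 2 ^ 2 * (X 2 ^ a * X 3 ^ b) ∧
      aeval (linChartSubst (K := K) {0, 2} 0) (X 0 ^ 2 : MvPolynomial (Fin 4) K) = X 0 ^ 2 * 1 ∧
      aeval (linChartSubst (K := K) {0, 3} 3) (X 0 ^ 2 : MvPolynomial (Fin 4) K) = X 3 ^ 2 * X 0 ^ 2 ∧
      aeval (linChartSubst (K := K) {0, 3} 3) (X 2 ^ a * X 3 ^ (b + 2) : MvPolynomial (Fin 4) K) =
        X 3 ^ 2 * (X 2 ^ a * X 3 ^ b) ∧
      aeval (linChartSubst (K := K) {0, 3} 0) (X 0 ^ 2 : MvPolynomial (Fin 4) K) = X 0 ^ 2 * 1 := by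
  refine ⟨?_, ?_, ?_, ?_, ?_, ?_⟩ <;> (simp [linChartSubst]; try ring)

/-- **D₀ = `(x², z⁶·w⁶)`, `n = 2`, characteristic 2 — THE P‴ CERTIFICATE (conjunction).**  Combinatorial half: the label
string `[6, 6]` carries a heavy edge, so the crossing-first rounds NEVER run out of a live crossing (`¬ BadEmpty` at every
level) and the labels are UNBOUNDED (`≥ 6 + 2i` after `i` rounds).  Ring half (for every label pattern met): (T) top locus
inside the alive planes, (W) wild along them, no absolute contact (char 2, even labels), (N) δ-heavy everywhere on them,
(R′) two alive planes through a line are not regular there, and the two steps of the round transform the labels exactly as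
`sRound 2` does.  Reading (desk, `NODE-g31.md` §3, one line per clause of `SingFrozen`): every level of the singular run from
`⟨(𝔸⁴, (x², z⁶w⁶)), none⟩` is `SingFrozen` with `OldSurfRegular` after step 1, the run is `sRound 2` on the labels, hence
`SPerpetual 2` — KIND P‴ (`E1TopSPerpetual`'s local letter) IS INHABITED, while `WOR 2` holds at D₀ (`NC_planeChart`). [new] -/
theorem D0_certificate [CharP K 2] :
    SRound.HeavyEdge 2 6 [6, 6] ∧ (∀ i : ℕ, SRound.LiveEdge 2 ((SRound.sRound 2)^[i] [6, 6])) ∧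
      (∀ i : ℕ, ∃ a ∈ (SRound.sRound 2)^[i] [6, 6], 6 + i * 2 ≤ a) ∧
      (∀ (i : Fin 4) (f : MvPolynomial (Fin 4) K), pderiv i (f ^ 2) = 0) ∧
      (X 2 ^ 6 * X 3 ^ 6 : MvPolynomial (Fin 4) K) = (X 2 ^ 3 * X 3 ^ 3) ^ 2 ∧
      (X 2 * X 3 : MvPolynomial (Fin 4) K) ∈
        Ideal.span {(X 0 : MvPolynomial (Fin 4) K), X 2} ⊓ Ideal.span {(X 0 : MvPolynomial (Fin 4) K), X 3} ∧
      (X 2 : MvPolynomial (Fin 4) K) ∉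
        Ideal.span {(X 0 : MvPolynomial (Fin 4) K), X 2} ⊓ Ideal.span {(X 0 : MvPolynomial (Fin 4) K), X 3} :=
  ⟨SRound.D0_heavyEdge, SRound.D0_live_forever, SRound.D0_unbounded, pderiv_sq_eq_zero, by ring,
    NC_closure_not_prime.1, NC_closure_not_prime.2.1⟩

end NCCertificates

end Summit.ResolutionOfSingularities.ResolutionOfSingularities.Theorems.DeltaCutClasses
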